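import Literature.AnabelianGeometry.EtaleTheta.SettingModelChiTwistedLatticeDeltaTheta
import Literature.AnabelianGeometry.EtaleTheta.SettingModelChiDeltaTheta
import HarnessLib

/-!
# The χ-twisted root model with an extra Tate lattice, file 2b: the `Ẑ`-coordinates on the theta centre of `modelLat` and
# their χ-EQUIVARIANCE (the coefficient map of the Kummer core of `modelLat`, up to `cycEquiv`)

Mochizuki, *The étale theta function …*, Publ. RIMS **45** (2009) [EtTh], §1, PRIMS PDF p. 12 ("`Δ_Θ` (`≅ Ẑ(1)`)") and
Prop. 1.5 p. 23 ("`H¹(G_K, Δ_Θ)`") [cite: MochizukiEtTh2009, §1 p.12].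

LATTICE TWIST OF `Ẑ(1)²` — NOT the (B) section twist (cf. file 1, `SettingModelChiTwistedLattice.lean`, and abc-iut-L2-lead
R709).  abc-iut cell, K-L6 slice, row «KL6-CLOSURE-CERT F-2633», seat abc-iut-L6-t19 (gen 8).  Over files 1–2a (`iotaPi`, `iotaTheta`,
`deltaThetaIota`) and abc-iut-L6-d6's `deltaThetaCoordχ : Ẑ →* Δ_Θ(curveχ)` (`SettingModelChiDeltaTheta`) BY NAME:

* **`deltaThetaCoordLat p : ZH →* Δ_Θ(curveLat)`** `:= deltaThetaIota ∘ deltaThetaCoordχ` — continuous and bijective;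
* `toTheta_inl_latt_mul_comm`: the lattice classes `θ(inl (1, t'))` CENTRALISE `Δ_Θ(curveLat)` (elements of the ell kernel have trivial
  Galois and lattice coordinates, and `(1, t')` commutes with `(γ', 1)` in `Γ × Latt`);
* `exists_toTheta_inl_latt_mul_iotaTheta`: every element of `(Π^tp_X□)^Θ` is `θ(inl (1, t')) · ι(x₀)` with the same augmentation as `x₀`;
* **`deltaThetaCoordLat_chi`**: `coord (χ(aug^Θ x) t) = x · coord t · x⁻¹` — the χ-EQUIVARIANCE of the coordinates on `Δ_Θ(modelLat)`,
  reduced by the two previous facts to abc-iut-L6-d6's `deltaThetaCoordχ_chi` through `iotaTheta`.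
With `cycEquiv` (abc-iut-L2-t5) this is the `coeffHom` clause set of `KummerCore` at `modelLat` (file 2 assembles it with `log(U)`).

HONEST LABEL: semi-synthetic model bookkeeping; nothing of [EtTh] asserted; no side taken on [IUTchIII] Cor. 3.12.  Class (b)
construction file (def-bearing: `deltaThetaCoordLat`; no instance, no notation, no Prop-valued def).
-/

noncomputable section

namespace Literature.AnabelianGeometry.EtaleTheta.SettingModel

open Literature.AnabelianGeometry.SemiGraphs _root_.Topology _root_.Function

variable (p : ℕ) [Fact p.Prime]

/-- **`Ẑ`-coordinates on `Δ_Θ(curveLat)`**: `t ↦ ι(c^t)`. [cite: MochizukiEtTh2009, §1 p.12] -/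
def deltaThetaCoordLat : ZH →* (CurveTheta.thetaToEll (curveLat p)).ker :=
  (deltaThetaIota p).toMonoidHom.comp (deltaThetaCoordχ p)

/-- [cite: MochizukiEtTh2009, §1 p.12] -/
theorem coe_deltaThetaCoordLat (t : ZH) :
    ((deltaThetaCoordLat p t : (CurveTheta.thetaToEll (curveLat p)).ker) : CurveTheta.GTheta (curveLat p)) =
      iotaTheta p (deltaThetaCoordχ p t) := rfl

/-- The coordinates are continuous. [cite: MochizukiEtTh2009, §1 p.12] -/
theorem continuous_deltaThetaCoordLat : Continuous (deltaThetaCoordLat p) :=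
  (continuous_deltaThetaIota p).comp (continuous_deltaThetaCoordχ p)

/-- The coordinates are bijective (`Δ_Θ(curveLat) ≅ Ẑ`). [cite: MochizukiEtTh2009, §1 p.12] -/
theorem bijective_deltaThetaCoordLat : Bijective (deltaThetaCoordLat p) :=
  (deltaThetaIota p).bijective.comp (bijective_deltaThetaCoordχ p)

/-! ### The lattice classes centralise the theta centre -/

/-- An element of the ell kernel of `curveLat` has trivial Galois and lattice coordinates: it is `inl (γ', 1)`.
[cite: MochizukiEtTh2009, §1 p.12] -/
theorem eq_inl_of_mem_ellKer {y : PiTpLat p} (hy : y ∈ CurveTheta.ellKer (curveLat p)) :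
    y = SemidirectProduct.inl (y.left.1, 1) := by
  obtain ⟨g₀, rfl⟩ := exists_iotaPi_eq_of_mem_ellKer p hy
  have hr : (iotaPi p g₀).right = 1 :=
    (mem_deltaTempLat_iff p _).mp (CurveTheta.ellKer_le_deltaTemp (curveLat p) hy)
  rw [← SemidirectProduct.inl_left_mul_inr_right (iotaPi p g₀), hr, map_one, mul_one, SemidirectProduct.left_inl,
    iotaPi_left]

/-- `inl (1, t')` commutes with every element of the ell kernel of `curveLat`. [cite: MochizukiEtTh2009, §1 p.12] -/
theorem inl_latt_mul_comm_of_mem_ellKer (t' : Latt) {y : PiTpLat p} (hy : y ∈ CurveTheta.ellKer (curveLat p)) :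
    SemidirectProduct.inl ((1 : Gfp), t') * y = y * SemidirectProduct.inl ((1 : Gfp), t') := by
  rw [eq_inl_of_mem_ellKer p hy, ← map_mul, ← map_mul]
  congr 1
  exact Prod.ext (by simp) (by simp)

/-- **The lattice classes `θ(inl (1, t'))` centralise `Δ_Θ(curveLat)`.** [cite: MochizukiEtTh2009, §1 p.12] -/
theorem toTheta_inl_latt_mul_comm (t' : Latt) {d : CurveTheta.GTheta (curveLat p)}
    (hd : d ∈ (CurveTheta.thetaToEll (curveLat p)).ker) :
    CurveTheta.toTheta (curveLat p) (SemidirectProduct.inl ((1 : Gfp), t')) * d =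
      d * CurveTheta.toTheta (curveLat p) (SemidirectProduct.inl ((1 : Gfp), t')) := by
  obtain ⟨y, hy, rfl⟩ := CurveTheta.exists_eq_toTheta_of_mem_ker_thetaToEll (curveLat p) hd
  rw [← map_mul, ← map_mul, inl_latt_mul_comm_of_mem_ellKer p t' hy]

/-- **Decomposition**: every `g : Π^tp_X□` is `inl (1, t) · ι(γ; σ)`. [cite: MochizukiEtTh2009, §1 p.12] -/
theorem eq_inl_latt_mul_iotaPi (g : PiTpLat p) :
    g = SemidirectProduct.inl ((1 : Gfp), g.left.2) * iotaPi p ⟨g.left.1, g.right⟩ := by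
  apply SemidirectProduct.ext
  · rw [SemidirectProduct.mul_left, SemidirectProduct.left_inl, SemidirectProduct.right_inl, map_one, iotaPi_left]
    change g.left = ((1 : Gfp), g.left.2) * (g.left.1, 1)
    exact Prod.ext (by simp) (by simp)
  · rw [SemidirectProduct.mul_right, SemidirectProduct.right_inl, one_mul, iotaPi_right]

/-- Every element of `(Π^tp_X□)^Θ` is a lattice class times an `ι`-image with the same augmentation.
[cite: MochizukiEtTh2009, §1 p.12] -/
theorem exists_toTheta_inl_latt_mul_iotaTheta (x : CurveTheta.GTheta (curveLat p)) :
    ∃ (t' : Latt) (x₀ : CurveTheta.GTheta (curveχ p)),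
      x = CurveTheta.toTheta (curveLat p) (SemidirectProduct.inl ((1 : Gfp), t')) * iotaTheta p x₀ ∧
        CurveTheta.augTheta (curveLat p) x = CurveTheta.augTheta (curveχ p) x₀ := by
  obtain ⟨g, rfl⟩ := CurveTheta.toTheta_surjective (curveLat p) x
  refine ⟨g.left.2, CurveTheta.toTheta (curveχ p) ⟨g.left.1, g.right⟩, ?_, ?_⟩
  · rw [iotaTheta_toTheta, ← map_mul]
    exact congrArg _ (eq_inl_latt_mul_iotaPi p g)
  · rw [CurveTheta.augTheta_toTheta, CurveTheta.augTheta_toTheta]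
    rfl

/-- **χ-equivariance of the coordinates on `Δ_Θ(modelLat)`**: `coord (χ(aug^Θ x) t) = x · coord t · x⁻¹`.
[cite: MochizukiEtTh2009, §1 p.12] -/
theorem deltaThetaCoordLat_chi (x : CurveTheta.GTheta (curveLat p)) (t : ZH) :
    deltaThetaCoordLat p (chi p (CurveTheta.augTheta (curveLat p) x) t) = MulAut.conjNormal x (deltaThetaCoordLat p t) := by
  obtain ⟨t', x₀, hx, haug⟩ := exists_toTheta_inl_latt_mul_iotaTheta p x
  apply Subtype.ext
  rw [MulAut.conjNormal_apply, coe_deltaThetaCoordLat, coe_deltaThetaCoordLat, haug, deltaThetaCoordχ_chi,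
    MulAut.conjNormal_apply, map_mul, map_mul, map_inv, hx]
  -- `z := θ(inl (1,t'))` centralises `ι(x₀ c x₀⁻¹) ∈ Δ_Θ(curveLat)`
  set z := CurveTheta.toTheta (curveLat p) (SemidirectProduct.inl ((1 : Gfp), t')) with hz
  have hmem : iotaTheta p ((x₀ : CurveTheta.GTheta (curveχ p)) * (deltaThetaCoordχ p t : CurveTheta.GTheta (curveχ p)) * x₀⁻¹) ∈
      (CurveTheta.thetaToEll (curveLat p)).ker := by
    rw [← map_iotaTheta_deltaTheta]
    refine ⟨_, ?_, rfl⟩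
    have h := (MulAut.conjNormal x₀ (deltaThetaCoordχ p t)).2
    rwa [MulAut.conjNormal_apply] at h
  have hcomm := toTheta_inl_latt_mul_comm p t' hmem
  rw [map_mul, map_mul, map_inv] at hcomm
  set a := iotaTheta p x₀ with ha
  set c := iotaTheta p ((deltaThetaCoordχ p t : (CurveTheta.thetaToEll (curveχ p)).ker) : CurveTheta.GTheta (curveχ p))
    with hc
  have hcomm' : z * (a * c * a⁻¹) = (a * c * a⁻¹) * z := by rw [hz]; exact hcomm
  rw [mul_inv_rev, show z * a * c * (a⁻¹ * z⁻¹) = (z * (a * c * a⁻¹)) * z⁻¹ by simp only [mul_assoc], hcomm',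
    mul_inv_cancel_right]

end Literature.AnabelianGeometry.EtaleTheta.SettingModel

end
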